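import Summits.QuantumFields.BalabanUV.Beta.CombChartStepJets
import Summits.QuantumFields.BalabanUV.Beta.CombLamSectorPeriodised
import Summits.QuantumFields.BalabanUV.Beta.SymSecondOrderTablesAn1
import Summits.QuantumFields.BalabanUV.Beta.KernelWardLevels
import Summits.QuantumFields.BalabanUV.Beta.WilsonReflectionContact
import Summits.QuantumFields.BalabanUV.Beta.FP.KernelPeriodisationFibLoc
import Summits.QuantumFields.BalabanUV.Beta.FP.TorusGaugeCovarianceCoarse

/-!
# `BalabanUV.Beta.CombHId1Currency` — binder row D1 (OWNER an2), (J-a) dictionary, the `hId₁` junction's CURRENCY LINE AT LEVEL 0: **leaf-02's PINNED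
# first-order slots `(H₁(w), Q₁₁ h)` of the level-0 door U21 ARE `(1∕cVH) •` THE RAW MEMBER's BLOCKS — EXACTLY WHEN `w = −2cΛ∕Lc⁸`**

HONEST DEPENDENCY (page 1, mandatory): continuum YM on T⁴ ⇐ BetaPertH ∧ nine spine estimates (0/9 proved); BetaPertH ⇐ (D1) ∧ (D4) ∧ CAP+tail;
G-an2-4 gates asym, D1 and NE2/3/4.  HONEST FRAMING (cell contract, verbatim): «discharging `BetaPertH` makes Bałaban's UV stability UNCONDITIONAL —
a real constructive-QFT result; it is NOT the continuum limit and NOT the Clay problem.»  ABSOLUTE RULE (cell charter, verbatim): «No internally-minted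
statement may enter as a cited fact. Every hypothesis is either kernel-proved in this package or a verbatim quotation of a PUBLISHED theorem with page
reference. The manuscript(s) under audit are NOT citable for their own disputed steps — they are the thing under adjudication; programme-internal
(2001/route/tribunal) claims are never citable.»

WHY.  an2 g43's `CombHId1Record.smul_graded_word_eq_table_succ_sub_fresh_an1` ∕ `CombHId1Door.door_hId1_at_record_an1` (and leaf-05 g33's junction probe J10)
state the (STEP) door's `hId₁` row at the (III′) literal with the first jets `H₁ Q₁₁` bound to the RAW level-`j` member `S_j := (JsB12CombSh0 hLc N (symTablesAn1S2 3 Lc cΛ) cΛ cB j).S`.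
leaf-02's level-0 door U21 (`FP/NestedStepLawTorusTransportedRowsGradedLevelZeroSymULowClosedLamW2Q2`) PINS its slots differently: `hH₁ : H₁ = (−2c₀) • Σ_b h b •
perF (dper (wilsonA 3 b))|_{ff} + Σ_b h b • (w • perF (dper (SLam Lc (lamCoeffOf KInv Lc) (symHessFFAt ρ_c Lc) b)))|_{ff}` with a DISPLAYED Λ-weight `w`, and
`hQ₁₁ : Q₁₁ h = Σ_b h b • perF (dper (symVhSAt ρ_c 3 Lc b))|_{(coarsePt·inr, inl)}` at unit weight.  THIS FILE is the currency line between the two bindings at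
level 0 (an2 g43 W-an2-g43-8, GO; adopted as the row's reading): since `S_0 = Lc⁴ • wilsonA + (−Lc⁸∕2) • symVhSAt ρ_c + cΛ • SLam Lc (lamCoeffOf KInv Lc) (symHessFFAt ρ_c)`
(`S0NOf`, `rfl`), `V = symVhSAt` is `ff`-free and `wilsonA`, `SLam … symHessFFAt` are `mf`-free, on ANY box
`H₁(w) = (−2∕Lc⁸) • Σ_b h b • perF (dper (S_0 b))|_{ff} + (w + 2cΛ∕Lc⁸) • Σ_b h b • perF (dper (Λ_0 b))|_{ff}` and `Q₁₁ h = (−2∕Lc⁸) • Σ_b h b • perF (dper (S_0 b))|_{(g·inr, inl)}`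
— the common road currency `1∕cVH = −2∕Lc⁸` (`stepScale 3 Lc 0 = 1`, so `−2c₀ = cE∕cVH`), and U21's free `w` is PINNED at `−2cΛ∕Lc⁸` (an2's `CombLamSectorLetters.lamWeight_eq`,
JA-TABLE §1 `λ`) by the requirement that BOTH slots carry the same currency (the door word is jointly linear in `(H₁, Q₁₁, Q₁₁ᵀ)`).

CONTENT ([folklore] `perF ∘ dper` linearity and block bookkeeping BY NAME over OUR typed objects; no `def`, no `def … : Prop`, nothing cited, 0 sorry):
§1 `JsB12CombSh0_S_zero_an1_apply` (`rfl`); §2 `perF_dper_S_zero_an1` (termwise periodisation — the level-0 twin of an2 g43's `CombHId1Record.perF_dper_ScombOf_succ`);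
§3 `perF_dper_apply_eq_zero_of_fibre` (a pointwise-zero fibre entry stays zero through `perF ∘ dper`); §4 **`torus_H1_levelZero_eq_raw`** (any `w`),
**`torus_H1_levelZero_eq_raw_of_lamWeight`** (`w = −2cΛ∕Lc⁸`), **`torus_Q11_levelZero_eq_raw`** (any `inr`-presentation `(g, m)`).
An identity between OUR two typed bindings; nothing of Bałaban's or of the dictionary's asserted, valued or discharged; 0 estimates; 0∕4 row-D1 binders
(hW, hR, D1Tel, D1Rep); NOT (J-a) complete, NOT (T-ID), NOT SDF, NOT D1, NEVER «G-an2-4 closed», NOT BetaPertH, NOT continuum, NOT Clay.  «not in print; our bookkeeping».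
Unit `b2b-balaban-beta-d1-formalise-leaf-05` (gen 33), 2026-08-22; no existing file touched.
-/

noncomputable section

namespace Summit.QuantumFields.BalabanUV.Beta.CombHId1Currency

open scoped BigOperators Matrix
open Finset
open Literature.MathematicalPhysics.QuantumFieldTheory.Balaban1983to89
open Literature.MathematicalPhysics.QuantumFieldTheory.Balaban1983to89.Beta
open B4TorusKernel.MultiPeriod (translate)
open B4Sect5Proof (latticeConst latticeConst_nonneg)
open B6Lemma24Torus (pbox)
open ExpKernelCalculus (MKer Decays BiLoc)
open AffineAveraging (Site)
open AveragingContoursRooted (ctr ctrOff_mem_box)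
open OneStepResolventKernel (Fib LocStencil KInv decays_KInv)
open InterLevelTransport (SLam)
open BalabanStepJets (lamCoeffOf)
open StepJetData (wilsonA locStencil_wilsonA)
open Summit.QuantumFields.BalabanUV.Beta.AxialDressingRooted (one_le_of_neZero)
open Summit.QuantumFields.BalabanUV.Beta.BorderedHessian (stepScale)
open Summit.QuantumFields.BalabanUV.Beta.KernelWardLevels (stepScale_zero)
open Summit.QuantumFields.BalabanUV.Beta.CombChartStepJets (JsB12CombSh0 JsB12CombSh0_eq JsComb0Of_S ScombOf_eq)
open Summit.QuantumFields.BalabanUV.Beta.WardLocusRecursive (SrecOf SrecOf_zero)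
open Summit.QuantumFields.BalabanUV.Beta.SpineRooted (S0NOf)
open Summit.QuantumFields.BalabanUV.Beta.SymAveragingHessianCounts (symVhSAt symHessFFAt symVhSAt_inl_inl symVhSAt_hV_ctr)
open Summit.QuantumFields.BalabanUV.Beta.SymSecondOrderTablesAn1 (symTablesAn1S2 symTablesAn1S2_V symTablesAn1S2_H)
open Summit.QuantumFields.BalabanUV.Beta.CombLamSectorLetters (SLam_an1TablesS2_inr)
open Summit.QuantumFields.BalabanUV.Beta.CombLamSectorPeriodised (locStencil_SLam_an1TablesS2)
open Summit.QuantumFields.BalabanUV.Beta.WilsonReflectionContact (wilsonA_inr_inl)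
open Summit.QuantumFields.BalabanUV.Beta.FP.KernelPeriodisationFib (Idx perF perF_apply perZ perZ_apply perF_add perF_smul)
open Summit.QuantumFields.BalabanUV.Beta.FP.KernelPeriodisationFibLoc (dper dper_apply summable_dper decays_dper_diag)
open Summit.QuantumFields.BalabanUV.Beta.FP.TorusGaugeCovarianceCoarse (coarsePt)

variable {Lc : ℕ} [NeZero Lc]

/-! ## §1 The RAW level-0 member of the (III′) literal, unfolded (`rfl`) -/

/-- [folklore] **`S_0 κ u = Lc⁴ • wilsonA 3 κ u + (−Lc⁸∕2) • symVhSAt ρ_c 3 Lc κ u + cΛ • SLam Lc (lamCoeffOf KInv Lc) (symHessFFAt ρ_c Lc) κ u`** — the level-0 first-order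
table of the comb-chart literal `JsB12CombSh0 hLc N (symTablesAn1S2 3 Lc cΛ) cΛ cB` (`JsB12CombSh0_eq`, `ScombOf_eq`, `SrecOf_zero`, `S0NOf`: definitional). -/
theorem JsB12CombSh0_S_zero_an1_apply (hLc : Odd Lc) (N : ℕ) (cΛ cB : ℝ) (κ : Fin (3 + 1)) (u : Site (3 + 1)) :
    (JsB12CombSh0 hLc N (symTablesAn1S2 3 Lc cΛ) cΛ cB 0).S κ u
      = ((Lc : ℝ) ^ 4) • wilsonA 3 κ u + (-((Lc : ℝ) ^ 8 / 2)) • symVhSAt (ctr (3 + 1) Lc) 3 Lc rfl κ u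
        + cΛ • SLam Lc (lamCoeffOf (KInv (N := Lc) (d := 3)) Lc) (symHessFFAt (ctr (3 + 1) Lc) Lc) κ u := by
  rw [JsB12CombSh0_eq, JsComb0Of_S, ScombOf_eq, SrecOf_zero]
  rfl

/-! ## §2 Termwise periodisation of the level-0 member (the level-0 twin of an2 g43's `CombHId1Record.perF_dper_ScombOf_succ`) -/

variable (M : Fin (3 + 1) → ℕ) [∀ μ, NeZero (M μ)]

/-- [folklore] termwise periodisation of a weighted three-term sum of bi-localised kernels (each period sum converges absolutely, `summable_dper`). -/
private theorem dper_add_smul₃ {X Y Z : MKer (3 + 1) (Fib 3)} {pX pY pZ : Site (3 + 1)} {CX δX CY δY CZ δZ : ℝ}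
    (hX : BiLoc X pX pX CX δX) (hδX : 0 < δX) (hY : BiLoc Y pY pY CY δY) (hδY : 0 < δY) (hZ : BiLoc Z pZ pZ CZ δZ) (hδZ : 0 < δZ)
    (a b c : ℝ) : dper M (a • X + b • Y + c • Z) = a • dper M X + b • dper M Y + c • dper M Z := by
  funext x y e f
  simp only [dper_apply, Pi.add_apply, Pi.smul_apply, smul_eq_mul]
  have h1 := (summable_dper M hX (hX.nonneg (Sum.inl 0)) hδX x y e f).mul_left a
  have h2 := (summable_dper M hY (hY.nonneg (Sum.inl 0)) hδY x y e f).mul_left b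
  have h3 := (summable_dper M hZ (hZ.nonneg (Sum.inl 0)) hδZ x y e f).mul_left c
  rw [(h1.add h2).tsum_add h3, h1.tsum_add h2, tsum_mul_left, tsum_mul_left, tsum_mul_left]

omit [∀ μ, NeZero (M μ)] in
/-- [folklore] `Decays (A + B) (CA + CB) δ` at a common rate. -/
private theorem decays_add' {A B : MKer (3 + 1) (Fib 3)} {CA CB δ : ℝ} (hA : Decays A CA δ) (hB : Decays B CB δ) : Decays (A + B) (CA + CB) δ :=
  fun x y a b => by
    rw [Pi.add_apply, Pi.add_apply, Pi.add_apply, Pi.add_apply, add_mul]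
    exact (abs_add_le _ _).trans (add_le_add (hA x y a b) (hB x y a b))

omit [∀ μ, NeZero (M μ)] in
/-- [folklore] `Decays (c • K) (|c|·C) δ`. -/
private theorem decays_smul' {K : MKer (3 + 1) (Fib 3)} {C δ : ℝ} (hK : Decays K C δ) (c : ℝ) : Decays (c • K) (|c| * C) δ := fun x y a b => by
  rw [Pi.smul_apply, Pi.smul_apply, Pi.smul_apply, Pi.smul_apply, smul_eq_mul, abs_mul, mul_assoc]
  exact mul_le_mul_of_nonneg_left (hK x y a b) (abs_nonneg c)

/-- [folklore] **THE COARSE-TORUS MATRICES OF THE RAW LEVEL-0 MEMBER SPLIT TERMWISE** (any box `M`):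
`perF M (dper M (S_0 κ u)) = Lc⁴ • perF M (dper M (wilsonA 3 κ u)) + (−Lc⁸∕2) • perF M (dper M (symVhSAt ρ_c 3 Lc κ u)) + cΛ • perF M (dper M (Λ_0 κ u))`,
`Λ_0 := SLam Lc (lamCoeffOf KInv Lc) (symHessFFAt ρ_c Lc)` (bi-localisation: `locStencil_wilsonA`, `symVhSAt_hV_ctr`, `CombLamSectorPeriodised.locStencil_SLam_an1TablesS2`). -/
theorem perF_dper_S_zero_an1 (hLc : Odd Lc) (N : ℕ) (cΛ cB : ℝ) (κ : Fin (3 + 1)) (u : Site (3 + 1)) :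
    perF M (dper M ((JsB12CombSh0 hLc N (symTablesAn1S2 3 Lc cΛ) cΛ cB 0).S κ u))
      = ((Lc : ℝ) ^ 4) • perF M (dper M (wilsonA 3 κ u))
        + (-((Lc : ℝ) ^ 8 / 2)) • perF M (dper M (symVhSAt (ctr (3 + 1) Lc) 3 Lc rfl κ u))
        + cΛ • perF M (dper M (SLam Lc (lamCoeffOf (KInv (N := Lc) (d := 3)) Lc) (symHessFFAt (ctr (3 + 1) Lc) Lc) κ u)) := by
  have hL1 : 1 ≤ Lc := one_le_of_neZero Lc
  have h1 : LocStencil (wilsonA 3) _ 1 := locStencil_wilsonA (d := 3) zero_le_one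
  obtain ⟨C₂, h2⟩ := symVhSAt_hV_ctr (d := 3) hL1 1 zero_le_one
  obtain ⟨C₃, δ₃, hC₃, hδ₃, h3⟩ := locStencil_SLam_an1TablesS2 (d := 3) (Lc := Lc)
  have hC₁ : 0 ≤ StepJetData.wBound 3 * Real.exp (4 * 1) := (h1 κ u).nonneg (Sum.inl 0)
  have hC₂ : 0 ≤ C₂ := (h2 κ u).nonneg (Sum.inl 0)
  have hd1 := decays_smul' (decays_dper_diag M (h1 κ u) hC₁ one_pos) ((Lc : ℝ) ^ 4)
  have hd2 := decays_smul' (decays_dper_diag M (h2 κ u) hC₂ one_pos) (-((Lc : ℝ) ^ 8 / 2))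
  have hd3 := decays_smul' (decays_dper_diag M (h3 κ u) hC₃ hδ₃) cΛ
  have hd12 := decays_add' hd1 hd2
  rw [JsB12CombSh0_S_zero_an1_apply hLc N cΛ cB κ u, dper_add_smul₃ M (h1 κ u) one_pos (h2 κ u) one_pos (h3 κ u) hδ₃,
    perF_add M hd12 hd3 (by norm_num) (half_pos hδ₃), perF_add M hd1 hd2 (by norm_num) (by norm_num),
    perF_smul, perF_smul, perF_smul]

/-! ## §3 Block readings through `perF ∘ dper` -/

omit [∀ μ, NeZero (M μ)] in
/-- [folklore] **a pointwise-zero fibre entry stays zero through `perF ∘ dper`**: if `V x z a b = 0` for all sites `x z`, then `perF M (dper M V) (s, a) (s′, b) = 0`. -/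
theorem perF_dper_apply_eq_zero_of_fibre {V : MKer (3 + 1) (Fib 3)} {a b : Fib 3} (hV : ∀ x z, V x z a b = 0) (s s' : ↥(pbox M)) :
    perF M (dper M V) (s, a) (s', b) = 0 := by
  simp only [perF_apply, perZ_apply, dper_apply, hV, tsum_zero]

/-! ## §4 The currency line for U21's pinned level-0 slots -/

/-- [folklore] **U21's PINNED `H₁(w)` IN TERMS OF THE RAW MEMBER** (any box `M`; `hH₁` = leaf-02's U21 binder VERBATIM with `fine Lc M′ ↦ M`; any weight `w`):
`H₁(w) = (−2∕Lc⁸) • Σ_b h b • perF (dper (S_0 b))|_{ff} + (w + 2cΛ∕Lc⁸) • Σ_b h b • perF (dper (Λ_0 b))|_{ff}` — the border table is `ff`-free (`symVhSAt_inl_inl`),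
`stepScale 3 Lc 0 = 1` so `−2c₀ = −2∕Lc⁴ = (−2∕Lc⁸)·Lc⁴`, and the Λ-sector's raw weight is `cΛ`. -/
theorem torus_H1_levelZero_eq_raw (hLc : Odd Lc) (N : ℕ) (cΛ cB : ℝ) (h : ↥(pbox M) × Fin (3 + 1) → ℝ) (w : ℝ)
    {H₁ : Matrix (↥(pbox M) × Fin (3 + 1)) (↥(pbox M) × Fin (3 + 1)) ℝ}
    (hH₁ : H₁ = ((-2 : ℝ) * (((Lc : ℝ) ^ (3 + 1) * stepScale 3 Lc 0)⁻¹)) • (∑ b : ↥(pbox M) × Fin (3 + 1), h b •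
        (perF M (dper M (wilsonA 3 b.2 (b.1 : Site (3 + 1))))).submatrix
          (fun b : ↥(pbox M) × Fin (3 + 1) => ((b.1, Sum.inl b.2) : Idx M (Fib 3)))
          (fun b : ↥(pbox M) × Fin (3 + 1) => ((b.1, Sum.inl b.2) : Idx M (Fib 3))))
      + ∑ b : ↥(pbox M) × Fin (3 + 1), h b •
        (w • (perF M (dper M
            (SLam Lc (lamCoeffOf (KInv (N := Lc) (d := 3)) Lc) (symHessFFAt (ctr (3 + 1) Lc) Lc) b.2 (b.1 : Site (3 + 1))))).submatrix
          (fun b : ↥(pbox M) × Fin (3 + 1) => ((b.1, Sum.inl b.2) : Idx M (Fib 3)))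
          (fun b : ↥(pbox M) × Fin (3 + 1) => ((b.1, Sum.inl b.2) : Idx M (Fib 3))))) :
    H₁ = (-2 / (Lc : ℝ) ^ 8) • ∑ b : ↥(pbox M) × Fin (3 + 1), h b •
          (perF M (dper M ((JsB12CombSh0 hLc N (symTablesAn1S2 3 Lc cΛ) cΛ cB 0).S b.2 (b.1 : Site (3 + 1))))).submatrix
            (fun b : ↥(pbox M) × Fin (3 + 1) => ((b.1, Sum.inl b.2) : Idx M (Fib 3)))
            (fun b : ↥(pbox M) × Fin (3 + 1) => ((b.1, Sum.inl b.2) : Idx M (Fib 3)))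
        + (w + 2 * cΛ / (Lc : ℝ) ^ 8) • ∑ b : ↥(pbox M) × Fin (3 + 1), h b •
          (perF M (dper M (SLam Lc (lamCoeffOf (KInv (N := Lc) (d := 3)) Lc) (symHessFFAt (ctr (3 + 1) Lc) Lc) b.2 (b.1 : Site (3 + 1))))).submatrix
            (fun b : ↥(pbox M) × Fin (3 + 1) => ((b.1, Sum.inl b.2) : Idx M (Fib 3)))
            (fun b : ↥(pbox M) × Fin (3 + 1) => ((b.1, Sum.inl b.2) : Idx M (Fib 3))) := by
  have hL : (Lc : ℝ) ≠ 0 := Nat.cast_ne_zero.2 (NeZero.ne Lc)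
  rw [hH₁]
  ext x z
  simp only [Matrix.add_apply, Matrix.smul_apply, Matrix.sum_apply, Matrix.submatrix_apply, smul_eq_mul,
    perF_dper_S_zero_an1 M hLc N cΛ cB,
    perF_dper_apply_eq_zero_of_fibre M (fun x' z' => symVhSAt_inl_inl (ctr (3 + 1) Lc) Lc _ _ x' z' _ _), stepScale_zero,
    Finset.mul_sum, ← Finset.sum_add_distrib]
  refine Finset.sum_congr rfl fun b _ => ?_
  field_simp
  ring

/-- [folklore] **… AT THE DICTIONARY's WEIGHT `w = −2cΛ∕Lc⁸`** (an2's `CombLamSectorLetters.lamWeight_eq`, JA-TABLE §1 `λ`): U21's pinned `H₁` IS `(−2∕Lc⁸) •` the RAW member's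
`ff`-table along `h` — the road currency `1∕cVH`, the SAME scalar as `torus_Q11_levelZero_eq_raw`. -/
theorem torus_H1_levelZero_eq_raw_of_lamWeight (hLc : Odd Lc) (N : ℕ) (cΛ cB : ℝ) (h : ↥(pbox M) × Fin (3 + 1) → ℝ) {w : ℝ}
    (hw : w = -(2 * cΛ) / (Lc : ℝ) ^ 8)
    {H₁ : Matrix (↥(pbox M) × Fin (3 + 1)) (↥(pbox M) × Fin (3 + 1)) ℝ}
    (hH₁ : H₁ = ((-2 : ℝ) * (((Lc : ℝ) ^ (3 + 1) * stepScale 3 Lc 0)⁻¹)) • (∑ b : ↥(pbox M) × Fin (3 + 1), h b •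
        (perF M (dper M (wilsonA 3 b.2 (b.1 : Site (3 + 1))))).submatrix
          (fun b : ↥(pbox M) × Fin (3 + 1) => ((b.1, Sum.inl b.2) : Idx M (Fib 3)))
          (fun b : ↥(pbox M) × Fin (3 + 1) => ((b.1, Sum.inl b.2) : Idx M (Fib 3))))
      + ∑ b : ↥(pbox M) × Fin (3 + 1), h b •
        (w • (perF M (dper M
            (SLam Lc (lamCoeffOf (KInv (N := Lc) (d := 3)) Lc) (symHessFFAt (ctr (3 + 1) Lc) Lc) b.2 (b.1 : Site (3 + 1))))).submatrix
          (fun b : ↥(pbox M) × Fin (3 + 1) => ((b.1, Sum.inl b.2) : Idx M (Fib 3)))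
          (fun b : ↥(pbox M) × Fin (3 + 1) => ((b.1, Sum.inl b.2) : Idx M (Fib 3))))) :
    H₁ = (-2 / (Lc : ℝ) ^ 8) • ∑ b : ↥(pbox M) × Fin (3 + 1), h b •
          (perF M (dper M ((JsB12CombSh0 hLc N (symTablesAn1S2 3 Lc cΛ) cΛ cB 0).S b.2 (b.1 : Site (3 + 1))))).submatrix
            (fun b : ↥(pbox M) × Fin (3 + 1) => ((b.1, Sum.inl b.2) : Idx M (Fib 3)))
            (fun b : ↥(pbox M) × Fin (3 + 1) => ((b.1, Sum.inl b.2) : Idx M (Fib 3))) := by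
  have hL : (Lc : ℝ) ≠ 0 := Nat.cast_ne_zero.2 (NeZero.ne Lc)
  have h0 : w + 2 * cΛ / (Lc : ℝ) ^ 8 = 0 := by rw [hw]; ring
  rw [torus_H1_levelZero_eq_raw M hLc N cΛ cB h w hH₁, h0, zero_smul, add_zero]

/-- [folklore] **U21's PINNED `Q₁₁ h` IN TERMS OF THE RAW MEMBER** (any box `M`, any coarse multiplier presentation `g : κ → ↥(pbox M)`, `m : κ → Fin 4` on `inr` slots;
`hQ₁₁` = leaf-02's binder shape at unit weight): `Q₁₁ h = (−2∕Lc⁸) • Σ_b h b • perF (dper (S_0 b))|_{(g·inr, inl)}` — the Wilson table and the Λ-sector are `mf`-free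
(`wilsonA_inr_inl`, `CombLamSectorLetters.SLam_an1TablesS2_inr`), and `(−2∕Lc⁸)·(−Lc⁸∕2) = 1`. -/
theorem torus_Q11_levelZero_eq_raw (hLc : Odd Lc) (N : ℕ) (cΛ cB : ℝ) (h : ↥(pbox M) × Fin (3 + 1) → ℝ)
    {κ : Type*} (g : κ → ↥(pbox M)) (m : κ → Fin (3 + 1))
    {Q₁₁ : Matrix κ (↥(pbox M) × Fin (3 + 1)) ℝ}
    (hQ₁₁ : Q₁₁ = ∑ b : ↥(pbox M) × Fin (3 + 1), h b •
        (perF M (dper M (symVhSAt (ctr (3 + 1) Lc) 3 Lc rfl b.2 (b.1 : Site (3 + 1))))).submatrix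
          (fun a : κ => ((g a, Sum.inr (m a)) : Idx M (Fib 3)))
          (fun b : ↥(pbox M) × Fin (3 + 1) => ((b.1, Sum.inl b.2) : Idx M (Fib 3)))) :
    Q₁₁ = (-2 / (Lc : ℝ) ^ 8) • ∑ b : ↥(pbox M) × Fin (3 + 1), h b •
        (perF M (dper M ((JsB12CombSh0 hLc N (symTablesAn1S2 3 Lc cΛ) cΛ cB 0).S b.2 (b.1 : Site (3 + 1))))).submatrix
          (fun a : κ => ((g a, Sum.inr (m a)) : Idx M (Fib 3)))
          (fun b : ↥(pbox M) × Fin (3 + 1) => ((b.1, Sum.inl b.2) : Idx M (Fib 3))) := by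
  have hL : (Lc : ℝ) ≠ 0 := Nat.cast_ne_zero.2 (NeZero.ne Lc)
  rw [hQ₁₁]
  ext a z
  simp only [Matrix.smul_apply, Matrix.sum_apply, Matrix.submatrix_apply, smul_eq_mul,
    perF_dper_S_zero_an1 M hLc N cΛ cB, Matrix.add_apply,
    perF_dper_apply_eq_zero_of_fibre M (fun x' z' => wilsonA_inr_inl (d := 3) _ _ x' z' _ _),
    perF_dper_apply_eq_zero_of_fibre M (fun x' z' => SLam_an1TablesS2_inr (d := 3) (Lc := Lc) _ _ _ x' z' _ _), Finset.mul_sum]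
  refine Finset.sum_congr rfl fun b _ => ?_
  field_simp
  ring

end Summit.QuantumFields.BalabanUV.Beta.CombHId1Currency

end
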